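import Literature.AlgebraicGeometry.Resolution.RegularHomReduced
import Literature.AlgebraicGeometry.Resolution.RegularLocalRingsNormal
import Literature.AlgebraicGeometry.Resolution.RegularHomLocalization
import Mathlib.RingTheory.Ideal.AssociatedPrime.Finiteness
import Mathlib.RingTheory.Regular.Flat
import Mathlib.RingTheory.DiscreteValuationRing.TFAE
import Mathlib.RingTheory.Localization.AtPrime.Basic
import HarnessLib

/-!
# Normality ascends along regular homomorphisms to local rings (Stacks 0BFK, local form) — without Serre's criterion

Topic: `Literature/AlgebraicGeometry/Resolution`. The Stacks Project, Tag 0BFK: "Let `φ : R → S`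
be a ring map. Assume (1) `φ` is regular, (2) `S` is Noetherian, and (3) `R` is Noetherian and
normal. Then `S` is normal." (proved there from Serre's criterion `(R₁) + (S₂)` and the ascent of
`(R_k)`, `(S_k)`), with its corollary Tag 0C23: "Let `(A, 𝔪)` be a Noetherian local ring. If `A`
is normal and the formal fibres of `A` are normal (for example if `A` is excellent or
quasi-excellent), then `A^∧` is normal" (Zariski's *analytic normality* of normal points).

This is the commutative algebra behind the sentence "Since `T_P` is normal, `T'_{P'}` is also
normal ibid. and (7.8.3)(v)" in Cossart–Piltant 2019, proof of journal Prop. 4.8 = arXiv v1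
Prop. 4.6 (p. 53), where `T' = T ⊗_A Â` for a quasi-excellent local domain `A`.

Mathlib has no depth theory to speak of and no Serre criterion; this file gives a DIRECT proof
of the local form of 0BFK for a normal DOMAIN base:

**Theorem** (`IsRegularHom.isDomain_and_isIntegrallyClosed`). Let `A` be a Noetherian integrally
closed domain, `A → B` a regular homomorphism (flat, geometrically regular fibres) with `B`
Noetherian and local. Then `B` is an integrally closed domain.

Proof. (1) `B` is reduced (Stacks 07QK, `IsRegularHom.isReduced`). (2) KEY
(`IsRegularHom.isRegularLocalRing_localization_of_colon`): if a prime `𝔓` of `B` is the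
annihilator of an element of `B/sB` for a nonzerodivisor `s`, then `B_𝔓` is regular. Indeed let
`𝔭 = 𝔓 ∩ A`; if `A_𝔭` is regular so is `B_𝔓` (ascent along regular maps, Matsumura 23.7);
otherwise `A_𝔭` is a non-regular normal local domain, hence for `0 ≠ a ∈ 𝔭` its maximal ideal
is not associated to `A_𝔭/a` (else `𝔪 (y/a) ⊆ A_𝔭` forces `𝔪` principal by the determinant
trick and normality — the argument of Mathlib's `maximalIdeal_isPrincipal_of_isDedekindDomain`),
so some `b ∈ 𝔭` is `A_𝔭/a`-regular; by flatness `b` is `B_𝔓/a`-regular; but exchanging `s` for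
`a` (`a ∈ 𝔓`, both nonzerodivisors) `𝔓` is also the annihilator of an element `ȳ` of `B/aB`,
and `b ∈ 𝔓` then forces `ȳ = 0` in `B_𝔓/aB_𝔓`, i.e. some `u ∉ 𝔓` kills `ȳ` — contradiction.
(3) `B` is integrally closed in its total ring of fractions (`isIntegrallyClosed_of_forall_colon`):
if `b/s` is integral and `b ∉ sB`, an associated prime `𝔓 ⊇ (sB : b)` of `B/sB` has `B_𝔓`
regular, hence an integrally closed domain (Matsumura 19.4), so `b ∈ sB_𝔓`, contradicting
`(sB : b) ⊆ 𝔓`. (4) A reduced Noetherian LOCAL ring integrally closed in its total ring of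
fractions is a domain (`isDomain_of_isReduced_of_isIntegrallyClosed`): with two minimal primes
one builds `b, c` with `bc = 0`, `s = b + c` a nonzerodivisor and `b/s` idempotent, hence in
`B`, hence `0` or `1` — absurd.

Everything is PROVED; no definitions, no named facts. Corollaries (completion of normal local
G-rings, Cossart–Piltant's `T'_{P'}`) are in `NormalAscentCompletion.lean`.

## Sources

* The Stacks Project, Tags 0BFK, 0C22, 0C23, 031S (Serre's criterion), 07QK. [StacksProject]
* H. Matsumura, *Commutative Ring Theory* (1986), Thm. 23.7, Thm. 23.9, Thm. 19.4, Thm. 14.3.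
  [Matsumura1987]
* V. Cossart, O. Piltant, arXiv:1412.0868v1, proof of Prop. 4.6, p. 53. [CossartPiltant2019]
-/

noncomputable section

open IsLocalRing

namespace Literature.AlgebraicGeometry.Resolution

universe u

/-! ## The exchange lemma for annihilators modulo nonzerodivisors -/

section Exchange

variable {B : Type u} [CommRing B]

/-- **Exchange lemma.** For nonzerodivisors `a, s` and `s y = a z`: `c y ∈ (a) ↔ c z ∈ (s)` for
every `c`. (So the annihilator of `ȳ ∈ B/aB` is that of `z̄ ∈ B/sB`: "depth one" does not depend
on the nonzerodivisor.) [folklore] -/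
theorem mul_mem_span_singleton_iff_of_mul_eq_mul {a s y z : B} (ha : a ∈ nonZeroDivisors B)
    (hs : s ∈ nonZeroDivisors B) (h : s * y = a * z) (c : B) :
    c * y ∈ Ideal.span {a} ↔ c * z ∈ Ideal.span {s} := by
  rw [Ideal.mem_span_singleton', Ideal.mem_span_singleton']
  constructor
  · rintro ⟨w, hw⟩
    refine ⟨w, ?_⟩
    -- `a (c z) = c (a z) = c s y = s (c y) = s w a`, cancel `a`
    have h1 : a * (c * z) = a * (w * s) := by
      calc a * (c * z) = c * (a * z) := by ring
        _ = c * (s * y) := by rw [h]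
        _ = s * (c * y) := by ring
        _ = s * (w * a) := by rw [hw]
        _ = a * (w * s) := by ring
    exact ((mul_cancel_left_mem_nonZeroDivisors ha).mp h1).symm
  · rintro ⟨w, hw⟩
    refine ⟨w, ?_⟩
    have h1 : s * (c * y) = s * (w * a) := by
      calc s * (c * y) = c * (s * y) := by ring
        _ = c * (a * z) := by rw [h]
        _ = a * (c * z) := by ring
        _ = a * (w * s) := by rw [hw]
        _ = s * (w * a) := by ring
    exact ((mul_cancel_left_mem_nonZeroDivisors hs).mp h1).symm

/-- Companion of the exchange lemma: `y ∈ (a) ↔ z ∈ (s)`. [folklore] -/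
theorem mem_span_singleton_iff_of_mul_eq_mul {a s y z : B} (ha : a ∈ nonZeroDivisors B)
    (hs : s ∈ nonZeroDivisors B) (h : s * y = a * z) :
    y ∈ Ideal.span {a} ↔ z ∈ Ideal.span {s} := by
  simpa only [one_mul] using mul_mem_span_singleton_iff_of_mul_eq_mul ha hs h 1

end Exchange

/-! ## Normal local domains: the maximal ideal is not associated to `A/aA` unless `A` is a DVR -/

section NormalLocal

variable {R : Type u} [CommRing R] [IsDomain R] [IsNoetherianRing R] [IsLocalRing R]

/-- **In a normal Noetherian local domain, if `𝔪` annihilates a nonzero element of `R/aR`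
(`a ≠ 0`) then `𝔪` is principal** (the "depth `≥ 2`" step in the proof of Serre's
criterion, Stacks 031S; the Lean proof is adapted from Mathlib's
`maximalIdeal_isPrincipal_of_isDedekindDomain`, Apache-2.0): with
`b ∉ aR` and `b𝔪 ⊆ aR`, either `(b/a)𝔪 ⊆ 𝔪`, and then `b/a` is integral over `R` by the
determinant trick, so `b/a ∈ R` by normality, absurd; or `(b/a)y = 1` for some `y ∈ 𝔪`, and then
`𝔪 = (y)`. [cite: StacksProject, Tag 031S] -/
theorem maximalIdeal_isPrincipal_of_mul_mem_span [IsIntegrallyClosed R] {a b : R}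
    (ha₁ : a ∈ maximalIdeal R) (ha₂ : a ≠ 0) (hb₂ : b ∉ Ideal.span {a})
    (hb₃ : ∀ m ∈ maximalIdeal R, ∃ k : R, k * a = b * m) : (maximalIdeal R).IsPrincipal := by
  have hb₄ : b ≠ 0 := by rintro rfl; apply hb₂; exact zero_mem _
  let K := FractionRing R
  let x : K := algebraMap R K b / algebraMap R K a
  let M := Submodule.map (Algebra.linearMap R K) (maximalIdeal R)
  have ha₃ : algebraMap R K a ≠ 0 := IsFractionRing.to_map_eq_zero_iff.not.mpr ha₂
  by_cases hx : ∀ y ∈ M, x * y ∈ M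
  · have := isIntegral_of_smul_mem_submodule M ?_ ?_ x hx
    · obtain ⟨y, e⟩ := IsIntegrallyClosed.algebraMap_eq_of_integral this
      refine (hb₂ (Ideal.mem_span_singleton'.mpr ⟨y, ?_⟩)).elim
      apply IsFractionRing.injective R K
      rw [map_mul, e, div_mul_cancel₀ _ ha₃]
    · rw [Submodule.ne_bot_iff]; refine ⟨_, ⟨a, ha₁, rfl⟩, ?_⟩
      exact (IsFractionRing.to_map_eq_zero_iff (K := K)).not.mpr ha₂
    · apply Submodule.FG.map; exact IsNoetherian.noetherian _
  · have :
        (M.map (DistribSMul.toLinearMap R K x)).comap (Algebra.linearMap R K) = ⊤ := by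
      contrapose! hx with h
      rintro m' ⟨m, hm, rfl : algebraMap R K m = m'⟩
      obtain ⟨k, hk⟩ := hb₃ m hm
      have hk' : x * algebraMap R K m = algebraMap R K k := by
        rw [← mul_div_right_comm, ← map_mul, ← hk, map_mul, mul_div_cancel_right₀ _ ha₃]
      exact ⟨k, le_maximalIdeal h ⟨_, ⟨_, hm, rfl⟩, hk'⟩, hk'.symm⟩
    obtain ⟨y, hy₁, hy₂⟩ : ∃ y ∈ maximalIdeal R, b * y = a := by
      rw [Ideal.eq_top_iff_one, Submodule.mem_comap] at this
      obtain ⟨_, ⟨y, hy, rfl⟩, hy' : x * algebraMap R K y = algebraMap R K 1⟩ := this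
      rw [map_one, ← mul_div_right_comm, div_eq_one_iff_eq ha₃, ← map_mul] at hy'
      exact ⟨y, hy, IsFractionRing.injective R K hy'⟩
    refine ⟨⟨y, ?_⟩⟩
    apply le_antisymm
    · intro m hm; obtain ⟨k, hk⟩ := hb₃ m hm; rw [← hy₂, mul_comm, mul_assoc] at hk
      rw [← mul_left_cancel₀ hb₄ hk, mul_comm]; exact Ideal.mem_span_singleton'.mpr ⟨_, rfl⟩
    · rwa [Submodule.span_le, Set.singleton_subset_iff]

/-- A Noetherian local domain with principal maximal ideal is a regular local ring (a field or a
discrete valuation ring; Mathlib's `tfae_of_isNoetherianRing_of_isLocalRing_of_isDomain`).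
[folklore] -/
theorem isRegularLocalRing_of_maximalIdeal_isPrincipal (h : (maximalIdeal R).IsPrincipal) :
    IsRegularLocalRing R := by
  haveI : IsPrincipalIdealRing R :=
    ((tfae_of_isNoetherianRing_of_isLocalRing_of_isDomain R).out 4 0).mp h
  infer_instance

/-- **Normal non-regular local domains have depth `≥ 2`**, elementarily: in a normal Noetherian
local domain `R` which is NOT regular, for every `a ∈ 𝔪 ∖ 0` there is `b ∈ 𝔪` which is a
nonzerodivisor on `R/aR` (`(a, b)` is a regular sequence). Otherwise `𝔪` consists of zero
divisors on `R/aR`, so lies in (the finite union of) its associated primes, so IS associated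
(prime avoidance), and then `𝔪` is principal (`maximalIdeal_isPrincipal_of_mul_mem_span`) and
`R` regular. [cite: StacksProject, Tag 031S] -/
theorem exists_mem_maximalIdeal_forall_mem_span [IsIntegrallyClosed R]
    (hreg : ¬ IsRegularLocalRing R) {a : R} (ha₁ : a ∈ maximalIdeal R) (ha₂ : a ≠ 0) :
    ∃ b ∈ maximalIdeal R, ∀ y : R, b * y ∈ Ideal.span {a} → y ∈ Ideal.span {a} := by
  classical
  by_contra hcon
  push Not at hcon
  apply hreg
  -- every element of `𝔪` is a zero divisor on `M = R/aR`
  let M := R ⧸ Ideal.span {a}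
  have hzd : (maximalIdeal R : Set R) ⊆ ⋃ p ∈ associatedPrimes R M, (p : Set R) := by
    intro b hb
    rw [biUnion_associatedPrimes_eq_zero_divisors]
    obtain ⟨y, hy, hy'⟩ := hcon b hb
    refine ⟨Ideal.Quotient.mk _ y, fun h0 => hy' (Ideal.Quotient.eq_zero_iff_mem.mp h0), ?_⟩
    rw [Algebra.smul_def, Ideal.Quotient.algebraMap_eq, ← map_mul, Ideal.Quotient.eq_zero_iff_mem]
    exact hy
  -- prime avoidance: `𝔪` is an associated prime of `R/aR`
  have hfin : (associatedPrimes R M).Finite := associatedPrimes.finite R M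
  have hzd' : (maximalIdeal R : Set R) ⊆ ⋃ p ∈ (hfin.toFinset : Set (Ideal R)), (p : Set R) := by
    rwa [Set.Finite.coe_toFinset]
  obtain ⟨p, hp, hle⟩ := (Ideal.subset_union_prime (maximalIdeal R) (maximalIdeal R)
    (fun q hq _ _ => ((Set.Finite.mem_toFinset hfin).mp hq).isPrime)).mp hzd'
  have hp' : IsAssociatedPrime p M := (Set.Finite.mem_toFinset hfin).mp hp
  have hpm : p = maximalIdeal R :=
    ((IsLocalRing.maximalIdeal.isMaximal R).eq_of_le hp'.isPrime.ne_top hle).symm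
  obtain ⟨-, x, hx⟩ := (isAssociatedPrime_iff (I := p) (M := M)).mp hp'
  obtain ⟨y, rfl⟩ := Ideal.Quotient.mk_surjective x
  -- `𝔪 = ann(ȳ)`: `c ∈ 𝔪 ↔ c y ∈ (a)`
  have hann : ∀ c : R, c ∈ maximalIdeal R ↔ c * y ∈ Ideal.span {a} := by
    intro c
    rw [← hpm, hx, Submodule.mem_colon_singleton, Submodule.mem_bot, Algebra.smul_def,
      Ideal.Quotient.algebraMap_eq, ← map_mul, Ideal.Quotient.eq_zero_iff_mem]
  have hy : y ∉ Ideal.span {a} := by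
    intro hy
    apply (IsLocalRing.maximalIdeal.isMaximal R).ne_top
    rw [Ideal.eq_top_iff_one, hann, one_mul]
    exact hy
  have hb₃ : ∀ m ∈ maximalIdeal R, ∃ k : R, k * a = y * m := by
    intro m hm
    have := (hann m).mp hm
    rw [Ideal.mem_span_singleton'] at this
    obtain ⟨k, hk⟩ := this
    exact ⟨k, by rw [hk, mul_comm]⟩
  exact isRegularLocalRing_of_maximalIdeal_isPrincipal
    (maximalIdeal_isPrincipal_of_mul_mem_span ha₁ ha₂ hy hb₃)

end NormalLocal

/-! ## Regularity modulo an element, and flat base change -/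

section QuotSMulTop

open scoped Pointwise

variable {R : Type u} [CommRing R]

/-- `x ∈ r • R ↔ x ∈ (r)`. [folklore] -/
theorem mem_smul_top_iff (r x : R) : x ∈ r • (⊤ : Submodule R R) ↔ x ∈ Ideal.span {r} := by
  rw [Submodule.mem_smul_pointwise_iff_exists, Ideal.mem_span_singleton']
  constructor
  · rintro ⟨b, -, rfl⟩
    exact ⟨b, by rw [smul_eq_mul, mul_comm]⟩
  · rintro ⟨b, rfl⟩
    exact ⟨b, Submodule.mem_top, by rw [smul_eq_mul, mul_comm]⟩

/-- `b` is `R/rR`-regular in the elementwise sense iff it is `IsSMulRegular` on `QuotSMulTop r R`.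
[folklore] -/
theorem isSMulRegular_quotSMulTop_of_forall {r b : R}
    (h : ∀ y : R, b * y ∈ Ideal.span {r} → y ∈ Ideal.span {r}) :
    IsSMulRegular (QuotSMulTop r R) b := by
  intro m₁ m₂ hm
  obtain ⟨x₁, rfl⟩ := Submodule.Quotient.mk_surjective _ m₁
  obtain ⟨x₂, rfl⟩ := Submodule.Quotient.mk_surjective _ m₂
  change b • Submodule.Quotient.mk x₁ = b • Submodule.Quotient.mk x₂ at hm
  rw [← Submodule.Quotient.mk_smul, ← Submodule.Quotient.mk_smul, Submodule.Quotient.eq,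
    mem_smul_top_iff, smul_eq_mul, smul_eq_mul, ← mul_sub] at hm
  rw [Submodule.Quotient.eq, mem_smul_top_iff]
  exact h _ hm

/-- Converse direction. [folklore] -/
theorem forall_mem_span_of_isSMulRegular_quotSMulTop {r b : R}
    (h : IsSMulRegular (QuotSMulTop r R) b) (y : R) (hy : b * y ∈ Ideal.span {r}) :
    y ∈ Ideal.span {r} := by
  have h1 : b • (Submodule.Quotient.mk y : QuotSMulTop r R) = b • 0 := by
    rw [smul_zero, ← Submodule.Quotient.mk_smul, Submodule.Quotient.mk_eq_zero, mem_smul_top_iff,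
      smul_eq_mul]
    exact hy
  have h2 := h h1
  rw [Submodule.Quotient.mk_eq_zero, mem_smul_top_iff] at h2
  exact h2

/-- **Flat base change of a regular sequence of length two** (Mathlib
`RingTheory.Sequence.IsWeaklyRegular.of_flat`, unpacked): for a flat `R`-algebra `S`, a
nonzerodivisor `a` of a domain `R` and `b` regular on `R/aR`, the image of `b` is regular on
`S/aS`. [folklore] -/
theorem forall_mem_span_algebraMap_of_flat {S : Type u} [CommRing S] [Algebra R S]
    [Module.Flat R S] {a b : R} (ha : IsSMulRegular R a)
    (hb : ∀ y : R, b * y ∈ Ideal.span {a} → y ∈ Ideal.span {a}) (w : S)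
    (hw : algebraMap R S b * w ∈ Ideal.span {algebraMap R S a}) :
    w ∈ Ideal.span {algebraMap R S a} := by
  have hseq : RingTheory.Sequence.IsWeaklyRegular R [a, b] := by
    rw [RingTheory.Sequence.isWeaklyRegular_cons_iff]
    refine ⟨ha, ?_⟩
    rw [RingTheory.Sequence.isWeaklyRegular_cons_iff]
    exact ⟨isSMulRegular_quotSMulTop_of_forall hb, RingTheory.Sequence.IsWeaklyRegular.nil _ _⟩
  have hseq' := hseq.of_flat (S := S)
  simp only [List.map_cons, List.map_nil, RingTheory.Sequence.isWeaklyRegular_cons_iff] at hseq'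
  exact forall_mem_span_of_isSMulRegular_quotSMulTop hseq'.2.1 w hw

end QuotSMulTop

/-! ## The key lemma: associated primes of principal ideals have regular local rings -/

section Key

variable {A B : Type u} [CommRing A] [IsDomain A] [IsNoetherianRing A] [IsIntegrallyClosed A]
  [CommRing B] [Algebra A B] [IsNoetherianRing B]

/-- **Key lemma** (the `(S₂) + (R₁)` content of Stacks 0BFK, directly): let `A` be a
Noetherian integrally closed domain and `A → B` a regular homomorphism with `B` Noetherian. If
a prime `𝔓` of `B` is the annihilator of an element `z̄` of `B/sB` for a nonzerodivisor `s`
(an associated prime of `B/sB`), then `B_𝔓` is a regular local ring. See the module docstring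
for the proof. [cite: StacksProject, Tag 0BFK] [cite: Matsumura1987, Thm. 23.9] -/
theorem IsRegularHom.isRegularLocalRing_localization_of_colon (h : IsRegularHom A B) {s z : B}
    (hs : s ∈ nonZeroDivisors B) (P : Ideal B) [P.IsPrime]
    (hP : ∀ c : B, c ∈ P ↔ c * z ∈ Ideal.span {s}) :
    IsRegularLocalRing (Localization.AtPrime P) := by
  classical
  haveI : Module.Flat A B := h.1
  set p : Ideal A := P.under A with hpdef
  by_cases hreg : IsRegularLocalRing (Localization.AtPrime p)
  · exact (h.isRegularLocalRing_localization_iff P).mpr hreg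
  exfalso
  set Ap := Localization.AtPrime p
  set Bp := Localization.AtPrime P
  have hpc : p.primeCompl ≤ nonZeroDivisors A :=
    le_nonZeroDivisors_of_noZeroDivisors fun h0 => h0 (zero_mem p)
  haveI : IsIntegrallyClosed Ap := isIntegrallyClosed_of_isLocalization Ap p.primeCompl hpc
  have hinjA : Function.Injective (algebraMap A Ap) := IsLocalization.injective Ap hpc
  -- `𝔭 ≠ 0` (else `A_𝔭` is a field, regular)
  obtain ⟨a, hap, ha0⟩ : ∃ a ∈ p, a ≠ 0 := by
    by_contra hcon
    push Not at hcon
    apply hreg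
    have hmax : maximalIdeal Ap = ⊥ := by
      rw [← Localization.AtPrime.map_eq_maximalIdeal, eq_bot_iff, Ideal.map_le_iff_le_comap]
      intro x hx
      rw [Ideal.mem_comap, hcon x hx, map_zero]
      exact Ideal.zero_mem _
    exact isRegularLocalRing_of_isField ((IsLocalRing.isField_iff_maximalIdeal_eq).mpr hmax)
  -- `a' ∈ 𝔪_{A_𝔭}`, nonzero; `b ∈ 𝔭` regular on `A_𝔭/a'`
  set a' : Ap := algebraMap A Ap a with ha'def
  have ha'm : a' ∈ maximalIdeal Ap := by
    rw [← Localization.AtPrime.map_eq_maximalIdeal]; exact Ideal.mem_map_of_mem _ hap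
  have ha'0 : a' ≠ 0 := fun h0 => ha0 (hinjA (h0.trans (map_zero _).symm))
  obtain ⟨b', hb'm, hb'reg⟩ := exists_mem_maximalIdeal_forall_mem_span hreg ha'm ha'0
  rw [← Localization.AtPrime.map_eq_maximalIdeal, IsLocalization.mem_map_algebraMap_iff
    p.primeCompl] at hb'm
  obtain ⟨⟨⟨b, hbp⟩, u⟩, hbu⟩ := hb'm
  -- `hbu : b' * algebraMap u = algebraMap b`
  have hbreg : ∀ y : Ap, algebraMap A Ap b * y ∈ Ideal.span {a'} → y ∈ Ideal.span {a'} := by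
    intro y hy
    have hu : IsUnit (algebraMap A Ap (u : A)) := IsLocalization.map_units Ap u
    have h1 : b' * (algebraMap A Ap (u : A) * y) ∈ Ideal.span {a'} := by
      rw [← mul_assoc]
      convert hy using 2
    have h2 := hb'reg _ h1
    have h3 : y = ((hu.unit⁻¹ : Apˣ) : Ap) * (algebraMap A Ap (u : A) * y) := by
      rw [← mul_assoc, IsUnit.val_inv_mul, one_mul]
    rw [h3]
    exact Ideal.mul_mem_left _ _ h2
  -- the flat local homomorphism `A_𝔭 → B_𝔓`
  letI : Algebra Ap Bp := Localization.AtPrime.algebraOfLiesOver p P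
  haveI : Module.Flat B Bp := IsLocalization.flat Bp P.primeCompl
  haveI : Module.Flat A Bp := Module.Flat.trans A B Bp
  haveI : Module.Flat Ap Bp :=
    (Module.flat_iff_of_isLocalization Ap p.primeCompl Bp).mpr inferInstance
  have ha'reg : IsSMulRegular Ap a' := fun x y hxy => mul_left_cancel₀ ha'0 hxy
  -- images in `B_𝔓`
  set a'' : Bp := algebraMap Ap Bp a' with ha''def
  have ha''eq : a'' = algebraMap B Bp (algebraMap A B a) := by
    rw [ha''def, ha'def, ← IsScalarTower.algebraMap_apply, IsScalarTower.algebraMap_apply A B Bp]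
  have hbeq : algebraMap Ap Bp (algebraMap A Ap b) = algebraMap B Bp (algebraMap A B b) := by
    rw [← IsScalarTower.algebraMap_apply, IsScalarTower.algebraMap_apply A B Bp]
  have hbBreg : ∀ w : Bp, algebraMap B Bp (algebraMap A B b) * w ∈ Ideal.span {a''} →
      w ∈ Ideal.span {a''} := fun w hw =>
    forall_mem_span_algebraMap_of_flat ha'reg hbreg w (by rw [hbeq]; exact hw)
  -- exchange: `𝔓` is the annihilator of `ȳ₀ ∈ B/aB`
  set aB : B := algebraMap A B a with haBdef
  have haB : aB ∈ nonZeroDivisors B := by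
    have h1 : IsSMulRegular B aB :=
      (show IsSMulRegular A a from fun x y hxy => mul_left_cancel₀ ha0 hxy).of_flat
    refine mem_nonZeroDivisors_iff_right.mpr fun t ht => h1 ?_
    change aB * t = aB * 0
    rw [mul_zero, mul_comm]
    exact ht
  have haP : aB ∈ P := by
    have : a ∈ P.under A := hap
    exact this
  obtain ⟨y₀, hy₀⟩ := Ideal.mem_span_singleton'.mp ((hP _).mp haP)
  -- `hy₀ : y₀ * s = aB * z`
  have hexch : ∀ c : B, c * y₀ ∈ Ideal.span {aB} ↔ c * z ∈ Ideal.span {s} :=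
    mul_mem_span_singleton_iff_of_mul_eq_mul haB hs (by rw [mul_comm]; exact hy₀)
  have hPy : ∀ c : B, c ∈ P ↔ c * y₀ ∈ Ideal.span {aB} := fun c => (hP c).trans (hexch c).symm
  -- `b ∈ 𝔓` kills `ȳ₀`, so `ȳ₀ = 0` in `B_𝔓/aB_𝔓` by regularity of `b` there
  have hbP : algebraMap A B b ∈ P := by
    have : b ∈ P.under A := hbp
    exact this
  have hby : algebraMap A B b * y₀ ∈ Ideal.span {aB} := (hPy _).mp hbP
  have h1 : algebraMap B Bp (algebraMap A B b) * algebraMap B Bp y₀ ∈ Ideal.span {a''} := by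
    obtain ⟨t, ht⟩ := Ideal.mem_span_singleton'.mp hby
    rw [← map_mul, ← ht, map_mul, ha''eq]
    exact Ideal.mul_mem_left _ _ (Ideal.subset_span rfl)
  have h2 := hbBreg _ h1
  rw [ha''eq, ← Set.image_singleton, ← Ideal.map_span,
    IsLocalization.mem_map_algebraMap_iff P.primeCompl Bp] at h2
  obtain ⟨⟨⟨t, ht⟩, ⟨v, hv⟩⟩, htv⟩ := h2
  -- `htv : algebraMap y₀ * algebraMap v = algebraMap t`
  simp only at htv
  rw [← map_mul] at htv
  obtain ⟨⟨c, hc⟩, hc'⟩ := (IsLocalization.eq_iff_exists P.primeCompl Bp).mp htv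
  -- `hc' : c * (y₀ * v) = c * t`
  have hmem : (c * v) * y₀ ∈ Ideal.span {aB} := by
    have : (c * v) * y₀ = c * t := by rw [← hc']; ring
    rw [this]
    exact Ideal.mul_mem_left _ _ ht
  have hcvP : c * v ∈ P := (hPy _).mpr hmem
  rcases ‹P.IsPrime›.mem_or_mem hcvP with h | h
  · exact hc h
  · exact hv h

end Key

/-! ## Integral closedness from the associated primes of principal ideals -/

section IntegrallyClosed

variable {B : Type u} [CommRing B] [IsNoetherianRing B]

/-- **Normality is decided at the associated primes of principal ideals** (the sufficiency half
of Serre's criterion, Stacks 031S, in the form needed here): if for every nonzerodivisor `s` and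
every prime `𝔓` which is the annihilator of an element of `B/sB` the local ring `B_𝔓` is an
integrally closed domain, then `B` is integrally closed in its total ring of fractions. Proof:
if `b/s` is integral and `b ∉ sB`, some associated prime `𝔓` of `B/sB` contains `(sB : b)`;
`b/s` is integral over the normal domain `B_𝔓`, so `b ∈ sB_𝔓`, i.e. `ub ∈ sB` for some
`u ∉ 𝔓` — contradiction. [cite: StacksProject, Tag 031S] -/
theorem isIntegrallyClosed_of_forall_colon
    (HK : ∀ (s z : B), s ∈ nonZeroDivisors B → ∀ (P : Ideal B) [P.IsPrime],
      (∀ c : B, c ∈ P ↔ c * z ∈ Ideal.span {s}) →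
        IsDomain (Localization.AtPrime P) ∧ IsIntegrallyClosed (Localization.AtPrime P)) :
    IsIntegrallyClosed B := by
  classical
  let K := FractionRing B
  refine (isIntegrallyClosed_iff K).mpr fun {x} hx => ?_
  obtain ⟨b, s, rfl⟩ := IsLocalization.exists_mk'_eq (nonZeroDivisors B) x
  by_cases hb : b ∈ Ideal.span {(s : B)}
  · obtain ⟨t, rfl⟩ := Ideal.mem_span_singleton'.mp hb
    exact ⟨t, by rw [IsLocalization.eq_mk'_iff_mul_eq, map_mul]⟩
  exfalso
  -- an associated prime `𝔓 ⊇ (sB : b)` of `B/sB`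
  let M := B ⧸ Ideal.span {(s : B)}
  have hne : (Ideal.Quotient.mk (Ideal.span {(s : B)}) b : M) ≠ 0 :=
    fun h0 => hb (Ideal.Quotient.eq_zero_iff_mem.mp h0)
  obtain ⟨P, hPass, hle⟩ := exists_le_isAssociatedPrime_of_isNoetherianRing B _ hne
  obtain ⟨hPprime, xz, hxz⟩ := (isAssociatedPrime_iff (I := P) (M := M)).mp hPass
  obtain ⟨z, rfl⟩ := Ideal.Quotient.mk_surjective xz
  haveI := hPprime
  have hP : ∀ c : B, c ∈ P ↔ c * z ∈ Ideal.span {(s : B)} := by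
    intro c
    rw [hxz, Submodule.mem_colon_singleton, Submodule.mem_bot, Algebra.smul_def,
      Ideal.Quotient.algebraMap_eq, ← map_mul, Ideal.Quotient.eq_zero_iff_mem]
  have hcolon : ∀ c : B, c * b ∈ Ideal.span {(s : B)} → c ∈ P := by
    intro c hc
    apply hle
    rw [Submodule.mem_colon_singleton, Submodule.mem_bot, Algebra.smul_def,
      Ideal.Quotient.algebraMap_eq, ← map_mul, Ideal.Quotient.eq_zero_iff_mem]
    exact hc
  obtain ⟨hdom, hic⟩ := HK s z s.2 P hP
  set Bp := Localization.AtPrime P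
  haveI := hdom
  haveI := hic
  haveI : Module.Flat B Bp := IsLocalization.flat Bp P.primeCompl
  -- nonzerodivisors of `B` stay nonzero in the domain `B_𝔓`
  have hnz : ∀ t : nonZeroDivisors B, algebraMap B Bp t ≠ 0 := by
    intro t ht
    have h1 : IsSMulRegular Bp (algebraMap B Bp t) := by
      have h0 : IsSMulRegular B (t : B) := fun x y hxy =>
        (mul_cancel_left_mem_nonZeroDivisors t.2).mp hxy
      exact h0.of_flat
    have h2 : algebraMap B Bp t * 1 = algebraMap B Bp t * 0 := by rw [ht, zero_mul, zero_mul]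
    exact one_ne_zero (h1 h2)
  -- `Frac B → Frac B_𝔓`
  let F := FractionRing Bp
  let g : B →+* F := (algebraMap Bp F).comp (algebraMap B Bp)
  have hg : ∀ t : nonZeroDivisors B, IsUnit (g t) := fun t =>
    (IsUnit.mk0 _ ((map_ne_zero_iff _ (IsFractionRing.injective Bp F)).mpr (hnz t)))
  let φ : K →+* F := IsLocalization.lift (M := nonZeroDivisors B) hg
  have hφ : ∀ y : B, φ (algebraMap B K y) = g y := fun y => IsLocalization.lift_eq hg y
  -- `φ (b/s)` is integral over `B_𝔓`
  obtain ⟨q, hqm, hq0⟩ := hx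
  have hint : IsIntegral Bp (φ (IsLocalization.mk' K b s)) := by
    refine ⟨q.map (algebraMap B Bp), hqm.map _, ?_⟩
    rw [Polynomial.eval₂_map]
    have h1 : (algebraMap Bp F).comp (algebraMap B Bp) = φ.comp (algebraMap B K) := by
      ext y; exact (hφ y).symm
    rw [h1, ← Polynomial.hom_eval₂, hq0, map_zero]
  obtain ⟨t, ht⟩ := (isIntegrallyClosed_iff F).mp hic hint
  -- `t * s = b` in `B_𝔓`
  have hφx : φ (IsLocalization.mk' K b s) * g s = g b := by
    rw [← hφ, ← hφ, ← map_mul, IsLocalization.mk'_spec]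
  have hts : t * algebraMap B Bp s = algebraMap B Bp b := by
    apply IsFractionRing.injective Bp F
    rw [map_mul, ht]
    exact hφx
  obtain ⟨t₀, u, rfl⟩ := IsLocalization.exists_mk'_eq P.primeCompl t
  -- clear denominators: `v u b = v t₀ s ∈ (s)` with `v u ∉ 𝔓`
  have h1 : algebraMap B Bp (t₀ * s) = algebraMap B Bp (b * u) := by
    rw [map_mul, map_mul, ← hts, mul_assoc, mul_comm (algebraMap B Bp (s : B)) _, ← mul_assoc,
      IsLocalization.mk'_spec]
  obtain ⟨⟨v, hv⟩, hv'⟩ := (IsLocalization.eq_iff_exists P.primeCompl Bp).mp h1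
  simp only at hv'
  have hmem : (v * u) * b ∈ Ideal.span {(s : B)} := by
    have : (v * u) * b = (v * t₀) * s := by
      calc (v * u) * b = v * (b * u) := by ring
        _ = v * (t₀ * s) := by rw [hv']
        _ = (v * t₀) * s := by ring
    rw [this]
    exact Ideal.mul_mem_left _ _ (Ideal.subset_span rfl)
  rcases hPprime.mem_or_mem (hcolon _ hmem) with h | h
  · exact hv h
  · exact u.2 h

end IntegrallyClosed

/-! ## Local, reduced and integrally closed in the total ring of fractions ⇒ domain -/

section Domain

variable {B : Type u} [CommRing B] [IsNoetherianRing B] [IsLocalRing B]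

/-- **A reduced Noetherian local ring which is integrally closed in its total ring of fractions
is a domain.** If `𝔓₁ ≠ 𝔓₂` are minimal primes, choose `b` in all minimal primes but `𝔓₁` and
`c ∈ 𝔓₁` outside the others (prime avoidance); then `bc = 0` (reduced), `s = b + c` is a
nonzerodivisor, and `(b/s)² = b/s`, so `b/s = t ∈ B` with `t` idempotent, `t ∈ {0, 1}` (local):
`b = 0` or `c = 0`, both absurd. [cite: StacksProject, Tag 031S] -/
theorem isDomain_of_isReduced_of_isIntegrallyClosed [IsReduced B] [IsIntegrallyClosed B] :
    IsDomain B := by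
  classical
  have hprime : ∀ Q ∈ minimalPrimes B, Q.IsPrime := fun Q hQ => hQ.1.1
  have hincomp : ∀ Q ∈ minimalPrimes B, ∀ Q' ∈ minimalPrimes B, Q ≤ Q' → Q = Q' :=
    fun Q hQ Q' hQ' hle => le_antisymm hle (hQ'.2 ⟨hQ.1.1, bot_le⟩ hle)
  -- an element of all minimal primes is nilpotent, hence zero
  have hzero : ∀ x : B, (∀ Q ∈ minimalPrimes B, x ∈ Q) → x = 0 := fun x hx => by
    have h1 : x ∈ sInf (minimalPrimes B) := by
      rw [Submodule.mem_sInf]; exact hx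
    rw [minimalPrimes, Ideal.sInf_minimalPrimes] at h1
    have h2 : x ∈ nilradical B := h1
    rwa [nilradical_eq_zero, Submodule.zero_eq_bot, Ideal.mem_bot] at h2
  -- it suffices that there is only one minimal prime
  suffices hsub : ∀ P₁ ∈ minimalPrimes B, ∀ P₂ ∈ minimalPrimes B, P₁ = P₂ by
    obtain ⟨P₀, hP₀, -⟩ := Ideal.exists_minimalPrimes_le
      (show (⊥ : Ideal B) ≤ maximalIdeal B from bot_le)
    have hP₀bot : ∀ x ∈ P₀, x = 0 := fun x hx =>
      hzero x fun Q hQ => (hsub Q hQ P₀ hP₀) ▸ hx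
    haveI : NoZeroDivisors B := ⟨fun {a b} hab => by
      have : a * b ∈ P₀ := by rw [hab]; exact Ideal.zero_mem _
      rcases (hprime P₀ hP₀).mem_or_mem this with h | h
      · exact Or.inl (hP₀bot a h)
      · exact Or.inr (hP₀bot b h)⟩
    exact NoZeroDivisors.to_isDomain B
  intro P₁ hP₁ P₂ hP₂
  by_contra hne
  have hfin := minimalPrimes.finite_of_isNoetherianRing B
  let Ps : Finset (Ideal B) := hfin.toFinset.erase P₁
  have hP₂Ps : P₂ ∈ Ps := Finset.mem_erase.mpr ⟨Ne.symm hne, hfin.mem_toFinset.mpr hP₂⟩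
  have hPs : ∀ Q ∈ Ps, Q ∈ minimalPrimes B ∧ Q ≠ P₁ := fun Q hQ =>
    ⟨hfin.mem_toFinset.mp (Finset.mem_of_mem_erase hQ), Finset.ne_of_mem_erase hQ⟩
  have hcover : ∀ Q ∈ minimalPrimes B, Q = P₁ ∨ Q ∈ Ps := fun Q hQ => by
    by_cases h : Q = P₁
    · exact Or.inl h
    · exact Or.inr (Finset.mem_erase.mpr ⟨h, hfin.mem_toFinset.mpr hQ⟩)
  -- `b` in all minimal primes but `P₁`
  obtain ⟨b, hb1, hb2⟩ : ∃ b : B, (∀ Q ∈ Ps, b ∈ Q) ∧ b ∉ P₁ := by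
    have : ¬ (Ps.inf id ≤ P₁) := by
      intro hle
      obtain ⟨Q, hQ, hQle⟩ := (Ideal.IsPrime.inf_le' (hprime P₁ hP₁)).mp hle
      exact (hPs Q hQ).2 (hincomp Q (hPs Q hQ).1 P₁ hP₁ hQle)
    obtain ⟨b, hb1, hb2⟩ := SetLike.not_le_iff_exists.mp this
    exact ⟨b, fun Q hQ => (Finset.inf_le hQ : Ps.inf id ≤ id Q) hb1, hb2⟩
  -- `c ∈ P₁` outside the other minimal primes
  obtain ⟨c, hc1, hc2⟩ : ∃ c ∈ P₁, ∀ Q ∈ Ps, c ∉ Q := by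
    have : ¬ ((P₁ : Set B) ⊆ ⋃ Q ∈ (Ps : Set (Ideal B)), ((Q : Ideal B) : Set B)) := by
      intro hsub'
      obtain ⟨Q, hQ, hle⟩ := (Ideal.subset_union_prime (f := fun Q : Ideal B => Q) P₂ P₂
        fun Q hQ _ _ => hprime Q (hPs Q hQ).1).mp hsub'
      exact (hPs Q hQ).2 (hincomp P₁ hP₁ Q (hPs Q hQ).1 hle).symm
    obtain ⟨c, hc1, hc2⟩ := Set.not_subset.mp this
    refine ⟨c, hc1, fun Q hQ hcQ => hc2 ?_⟩
    exact Set.mem_iUnion₂.mpr ⟨Q, Finset.mem_coe.mpr hQ, hcQ⟩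
  -- `s = b + c` avoids all minimal primes: a nonzerodivisor; `bc = 0`
  have hsQ : ∀ Q ∈ minimalPrimes B, b + c ∉ Q := by
    intro Q hQ hs
    rcases hcover Q hQ with rfl | hQ'
    · exact hb2 (by simpa using Q.sub_mem hs hc1)
    · exact hc2 Q hQ' (by simpa using Q.sub_mem hs (hb1 Q hQ'))
  have hsnzd : b + c ∈ nonZeroDivisors B := by
    refine mem_nonZeroDivisors_iff_right.mpr fun t ht => hzero t fun Q hQ => ?_
    rcases (hprime Q hQ).mem_or_mem (show t * (b + c) ∈ Q by rw [ht]; exact Q.zero_mem)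
      with h | h
    · exact h
    · exact (hsQ Q hQ h).elim
  have hbc : b * c = 0 := hzero _ fun Q hQ => by
    rcases hcover Q hQ with rfl | hQ'
    · exact Q.mul_mem_left _ hc1
    · exact Q.mul_mem_right _ (hb1 Q hQ')
  -- the idempotent `b/s` of the total ring of fractions
  let K := FractionRing B
  let x : K := IsLocalization.mk' K b ⟨b + c, hsnzd⟩
  have hx2 : x * x = x := by
    rw [← IsLocalization.mk'_mul, IsLocalization.mk'_eq_iff_eq]
    congr 1
    simp only [Submonoid.coe_mul]
    calc (b + c) * (b * b) = (b + c) * (b * b) + (b + c) * (b * c) := by rw [hbc, mul_zero, add_zero]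
      _ = (b + c) * (b + c) * b := by ring
  have hint : IsIntegral B x := by
    refine ⟨Polynomial.X * (Polynomial.X - Polynomial.C 1), Polynomial.monic_X.mul
      (Polynomial.monic_X_sub_C 1), ?_⟩
    simp only [Polynomial.eval₂_mul, Polynomial.eval₂_X, Polynomial.eval₂_sub, map_one, mul_sub,
      mul_one, hx2, sub_self]
  obtain ⟨t, ht⟩ := (isIntegrallyClosed_iff K).mp ‹IsIntegrallyClosed B› hint
  have hinj := IsFractionRing.injective B K
  have htt : t * t = t := hinj (by rw [map_mul, ht, hx2])
  have htb : t * (b + c) = b := by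
    apply hinj
    rw [map_mul]
    exact IsLocalization.eq_mk'_iff_mul_eq.mp ht
  rcases IsLocalRing.isUnit_or_isUnit_one_sub_self t with hu | hu
  · -- `t` is a unit: `t = 1`, so `c = 0 ∈ P₂`
    have ht1 : t = 1 := hu.mul_left_cancel (htt.trans (mul_one t).symm)
    rw [ht1, one_mul] at htb
    have hc0 : c = 0 := by linear_combination htb
    exact hc2 P₂ hP₂Ps (hc0 ▸ P₂.zero_mem)
  · -- `1 - t` is a unit: `t = 0`, so `b = 0 ∈ P₁`
    have ht0 : t = 0 := by
      have h1 : (1 - t) * t = (1 - t) * 0 := by rw [mul_zero, sub_mul, one_mul, htt, sub_self]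
      exact hu.mul_left_cancel h1
    rw [ht0, zero_mul] at htb
    exact hb2 (htb ▸ P₁.zero_mem)

end Domain

/-! ## The theorem -/

/-- **Normality ascends along regular homomorphisms to local rings** (Stacks 0BFK, local form,
normal domain base; Matsumura Thm. 23.9 for the formal fibres): let `A` be a Noetherian
integrally closed domain and `A → B` a regular homomorphism with `B` Noetherian and local. Then
`B` is an integrally closed domain. Proof in the module docstring: `B` is reduced (Stacks 07QK),
associated primes of principal ideals generated by nonzerodivisors have regular local rings
(`IsRegularHom.isRegularLocalRing_localization_of_colon`), hence `B` is integrally closed in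
its total ring of fractions (`isIntegrallyClosed_of_forall_colon`, regular local rings being
normal domains, Matsumura 14.3 and 19.4), hence a domain (`isDomain_of_isReduced_of_isIntegrallyClosed`).
[cite: StacksProject, Tag 0BFK] [cite: Matsumura1987, Thm. 23.9] -/
theorem IsRegularHom.isDomain_and_isIntegrallyClosed {A B : Type u} [CommRing A] [IsDomain A]
    [IsNoetherianRing A] [IsIntegrallyClosed A] [CommRing B] [IsLocalRing B] [IsNoetherianRing B]
    [Algebra A B] (h : IsRegularHom A B) : IsDomain B ∧ IsIntegrallyClosed B := by
  haveI : IsReduced B := h.isReduced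
  haveI hIC : IsIntegrallyClosed B :=
    isIntegrallyClosed_of_forall_colon fun s z hs P _ hP => by
      haveI := h.isRegularLocalRing_localization_of_colon hs P hP
      exact ⟨isDomain_of_isRegularLocalRing _, isIntegrallyClosed_of_isRegularLocalRing _⟩
  exact ⟨isDomain_of_isReduced_of_isIntegrallyClosed (B := B), hIC⟩

/-- The same, prime by prime, for a Noetherian target which need not be local: every local ring
`B_𝔔` of `B` is an integrally closed domain (`B` is normal). The composite `A → B → B_𝔔` is
regular (`IsRegularHom.comp_isLocalization_right`). [cite: StacksProject, Tag 0BFK] -/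
theorem IsRegularHom.isDomain_and_isIntegrallyClosed_localization {A B : Type u} [CommRing A]
    [IsDomain A] [IsNoetherianRing A] [IsIntegrallyClosed A] [CommRing B] [IsNoetherianRing B]
    [Algebra A B] (h : IsRegularHom A B) (Q : Ideal B) [Q.IsPrime] :
    IsDomain (Localization.AtPrime Q) ∧ IsIntegrallyClosed (Localization.AtPrime Q) :=
  haveI : IsNoetherianRing (Localization.AtPrime Q) :=
    IsLocalization.isNoetherianRing Q.primeCompl _ inferInstance
  (h.comp_isLocalization_right Q.primeCompl (Localization.AtPrime Q)).isDomain_and_isIntegrallyClosed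

end Literature.AlgebraicGeometry.Resolution
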